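import Mathlib
import Summits.QuantumFields.YangMills.Theorems.UniversalDetectorLatticeRiemannBounds

/-!
# Route `UniversalDetector`, support item `LimitExtraction` (stmt-QuantumFields-26597): perturbation of double lattice sums

Ideator seat ym-idea-8 g4.  Third piece of the toolkit for the `Q2`-convergence conjunct of `LimitExtraction`
(with `UniversalDetectorLatticeRiemannBounds` and `UniversalDetectorLatticeRiemannLimit`):
`tendsto_latticeDoubleSum_perturbation` — inside the Schwartz-weighted normalised double sum
`s_k^{2d} Σ_{x,x' ∈ box d L_k} w₁(s_k x) w₂(s_k x') (·)` one may replace a pair function `Φ_k` by `Θ_k` at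
vanishing cost, provided `|Φ_k - Θ_k| ≤ M` on the charged pairs and `|Φ_k - Θ_k| ≤ ε` on the charged pairs with
`‖s_k x‖, ‖s_k x'‖ ≤ R` (eventually in `k`, every `R, ε > 0`).  For NT: `Φ_k = a_k^{-8} Cov_k`, `Θ_k(x,x') =
K(a_k x' - a_k x)`; `M` comes from (TIGHT) at physical time separation `≥ 2t₀` (opposite slabs, `a_k L_k > 2T`
kills time wrap-around), the `ε`-closeness from the local uniform convergence of the rescaled covariance kernel;
`UniversalDetectorLatticeRiemannLimit.tendsto_latticeRiemannSum₂` then evaluates the `Θ`-sum.  The proof is the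
`ε/R` bookkeeping on top of the uniform total/tail bounds of `UniversalDetectorLatticeRiemannBounds`.
No summit, leg or spine statement is proved here.
-/

set_option autoImplicit false

namespace Summit.QuantumFields.YangMills.Cruxes.UniversalDetectorLimitExtraction

open Finset Filter Topology Literature.Probability.LatticeModels Literature.MathematicalPhysics.QuantumLattice

/-- **Perturbation of Schwartz-weighted double lattice sums.**  If two families of pair functions
`Φ_k, Θ_k` on the box differ by at most `M` on the pairs charged by the weights `w₁(s_k x) w₂(s_k x')`
(eventually in `k`), and by at most `ε` on the charged pairs with `‖s_k x‖, ‖s_k x'‖ ≤ R` (eventually in `k`,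
for every `R, ε > 0`), then the normalised double sums `s_k^{2d} Σ_{x,x'} w₁(s_k x) w₂(s_k x') (Φ_k - Θ_k)(x,x')`
tend to `0` (`0 < s_k`, eventually `s_k ≤ 1`).  For NT's `Q2`: `Φ_k(x,x') = a_k^{-8} Cov_k(A_x, A_{x'})`,
`Θ_k(x,x') = K(a_k x' - a_k x)`, `M` from (TIGHT) at physical separation `≥ 2t₀`, the `ε`-closeness from the
local uniform convergence of the rescaled covariance kernel to `K`. -/
theorem tendsto_latticeDoubleSum_perturbation {d : ℕ}
    (w₁ w₂ : SchwartzMap (EuclideanSpace ℝ (Fin d)) ℝ) (Φ Θ : ℕ → Site d → Site d → ℝ)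
    (s : ℕ → ℝ) (hs : ∀ k, 0 < s k) (hs1 : ∀ᶠ k in atTop, s k ≤ 1) (L : ℕ → ℕ) (M : ℝ)
    (hM : ∀ᶠ k in atTop, ∀ x ∈ box d (L k), ∀ x' ∈ box d (L k),
      w₁ (s k • siteToE x) ≠ 0 → w₂ (s k • siteToE x') ≠ 0 → |Φ k x x' - Θ k x x'| ≤ M)
    (hnear : ∀ R ε : ℝ, 0 < R → 0 < ε → ∀ᶠ k in atTop, ∀ x ∈ box d (L k), ∀ x' ∈ box d (L k),
      ‖s k • siteToE x‖ ≤ R → ‖s k • siteToE x'‖ ≤ R →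
      w₁ (s k • siteToE x) ≠ 0 → w₂ (s k • siteToE x') ≠ 0 → |Φ k x x' - Θ k x x'| ≤ ε) :
    Tendsto (fun k => (s k ^ d) ^ 2 * ∑ x ∈ box d (L k), ∑ x' ∈ box d (L k),
      w₁ (s k • siteToE x) * w₂ (s k • siteToE x') * (Φ k x x' - Θ k x x')) atTop (𝓝 0) := by
  obtain ⟨B₁, hB₁0, hB₁⟩ := schwartz_latticeRiemannBound w₁
  obtain ⟨B₂, hB₂0, hB₂⟩ := schwartz_latticeRiemannBound w₂
  obtain ⟨B₁', hB₁'0, hB₁'⟩ := schwartz_latticeRiemannTail w₁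
  obtain ⟨B₂', hB₂'0, hB₂'⟩ := schwartz_latticeRiemannTail w₂
  have hMp0 : 0 ≤ max M 0 := le_max_right _ _
  have hMMp : M ≤ max M 0 := le_max_left _ _
  rw [Metric.tendsto_nhds]
  intro ε hε
  -- the cut-off radius
  have hR : ∃ R : ℝ, 1 ≤ R ∧ max M 0 * (B₁' * B₂ + B₁ * B₂') / (1 + R) < ε / 2 := by
    have ht : Tendsto (fun R : ℝ => max M 0 * (B₁' * B₂ + B₁ * B₂') / (1 + R)) atTop (𝓝 0) :=
      tendsto_const_nhds.div_atTop (tendsto_atTop_add_const_left _ _ tendsto_id)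
    obtain ⟨R, hR⟩ := ((ht.eventually (gt_mem_nhds (half_pos hε))).and (eventually_ge_atTop 1)).exists
    exact ⟨R, hR.2, hR.1⟩
  obtain ⟨R, hR1, hRε⟩ := hR
  have hR0 : 0 < R := by linarith
  -- the near tolerance
  obtain ⟨εn, hεn0, hεn⟩ : ∃ εn : ℝ, 0 < εn ∧ εn * (B₁ * B₂) < ε / 2 :=
    ⟨ε / (2 * (B₁ * B₂ + 1)), by positivity, by
      rw [div_mul_eq_mul_div, div_lt_div_iff₀ (by positivity) (by positivity)]; nlinarith⟩
  filter_upwards [hs1, hM, hnear R εn hR0 hεn0] with k hk1 hkM hkn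
  rw [dist_zero_right, Real.norm_eq_abs]
  have hsk := hs k
  -- termwise bound: near pairs cost `εn`, far pairs carry a tail weight
  have hterm : ∀ x ∈ box d (L k), ∀ x' ∈ box d (L k),
      |w₁ (s k • siteToE x) * w₂ (s k • siteToE x') * (Φ k x x' - Θ k x x')| ≤
        εn * (|w₁ (s k • siteToE x)| * |w₂ (s k • siteToE x')|) +
        max M 0 * ((if R ≤ ‖s k • siteToE x‖ then |w₁ (s k • siteToE x)| else 0) * |w₂ (s k • siteToE x')|) +
        max M 0 * (|w₁ (s k • siteToE x)| *
          (if R ≤ ‖s k • siteToE x'‖ then |w₂ (s k • siteToE x')| else 0)) := by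
    intro x hx x' hx'
    have ha : 0 ≤ |w₁ (s k • siteToE x)| := abs_nonneg _
    have hb : 0 ≤ |w₂ (s k • siteToE x')| := abs_nonneg _
    have hu : 0 ≤ (if R ≤ ‖s k • siteToE x‖ then |w₁ (s k • siteToE x)| else 0) := by
      split_ifs; exacts [abs_nonneg _, le_rfl]
    have hv : 0 ≤ (if R ≤ ‖s k • siteToE x'‖ then |w₂ (s k • siteToE x')| else 0) := by
      split_ifs; exacts [abs_nonneg _, le_rfl]
    have hrest : 0 ≤ max M 0 * ((if R ≤ ‖s k • siteToE x‖ then |w₁ (s k • siteToE x)| else 0) *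
        |w₂ (s k • siteToE x')|) + max M 0 * (|w₁ (s k • siteToE x)| *
          (if R ≤ ‖s k • siteToE x'‖ then |w₂ (s k • siteToE x')| else 0)) := by positivity
    rw [abs_mul, abs_mul]
    by_cases h1 : w₁ (s k • siteToE x) = 0
    · simp [h1]
    by_cases h2 : w₂ (s k • siteToE x') = 0
    · simp [h2]
    by_cases hn : ‖s k • siteToE x‖ ≤ R ∧ ‖s k • siteToE x'‖ ≤ R
    · have hc := hkn x hx x' hx' hn.1 hn.2 h1 h2
      calc |w₁ (s k • siteToE x)| * |w₂ (s k • siteToE x')| * |Φ k x x' - Θ k x x'|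
          ≤ |w₁ (s k • siteToE x)| * |w₂ (s k • siteToE x')| * εn :=
            mul_le_mul_of_nonneg_left hc (mul_nonneg ha hb)
        _ = εn * (|w₁ (s k • siteToE x)| * |w₂ (s k • siteToE x')|) := by ring
        _ ≤ _ := by linarith
    · have hc := (hkM x hx x' hx' h1 h2).trans hMMp
      have hfirst : 0 ≤ εn * (|w₁ (s k • siteToE x)| * |w₂ (s k • siteToE x')|) := by positivity
      rw [not_and_or, not_le, not_le] at hn
      have hmain : |w₁ (s k • siteToE x)| * |w₂ (s k • siteToE x')| * |Φ k x x' - Θ k x x'| ≤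
          max M 0 * (|w₁ (s k • siteToE x)| * |w₂ (s k • siteToE x')|) := by
        calc |w₁ (s k • siteToE x)| * |w₂ (s k • siteToE x')| * |Φ k x x' - Θ k x x'|
            ≤ |w₁ (s k • siteToE x)| * |w₂ (s k • siteToE x')| * max M 0 :=
              mul_le_mul_of_nonneg_left hc (mul_nonneg ha hb)
          _ = _ := by ring
      rcases hn with hfar | hfar
      · rw [if_pos hfar.le]
        have : 0 ≤ max M 0 * (|w₁ (s k • siteToE x)| *
            (if R ≤ ‖s k • siteToE x'‖ then |w₂ (s k • siteToE x')| else 0)) := by positivity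
        linarith
      · rw [if_pos hfar.le]
        have : 0 ≤ max M 0 * ((if R ≤ ‖s k • siteToE x‖ then |w₁ (s k • siteToE x)| else 0) *
            |w₂ (s k • siteToE x')|) := by positivity
        linarith
  -- the one-dimensional sums
  have hS₁ := hB₁ (L k) (s k) hsk hk1
  have hS₂ := hB₂ (L k) (s k) hsk hk1
  have hU₁ : s k ^ d * ∑ x ∈ box d (L k), (if R ≤ ‖s k • siteToE x‖ then |w₁ (s k • siteToE x)| else 0) ≤
      B₁' / (1 + R) := by
    have h := hB₁' (L k) (s k) R hsk hk1 hR0.le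
    rwa [sum_filter] at h
  have hU₂ : s k ^ d * ∑ x ∈ box d (L k), (if R ≤ ‖s k • siteToE x‖ then |w₂ (s k • siteToE x)| else 0) ≤
      B₂' / (1 + R) := by
    have h := hB₂' (L k) (s k) R hsk hk1 hR0.le
    rwa [sum_filter] at h
  have hT₂0 : 0 ≤ s k ^ d * ∑ x ∈ box d (L k), |w₂ (s k • siteToE x)| :=
    mul_nonneg (pow_nonneg hsk.le d) (sum_nonneg fun x _ => abs_nonneg _)
  have hV₂0 : 0 ≤ s k ^ d * ∑ x ∈ box d (L k),
      (if R ≤ ‖s k • siteToE x‖ then |w₂ (s k • siteToE x)| else 0) :=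
    mul_nonneg (pow_nonneg hsk.le d) (sum_nonneg fun x _ => by split_ifs; exacts [abs_nonneg _, le_rfl])
  have key : ∀ f g : Site d → ℝ, ∑ x ∈ box d (L k), ∑ x' ∈ box d (L k), f x * g x' =
      (∑ x ∈ box d (L k), f x) * (∑ x ∈ box d (L k), g x) := fun f g => (sum_mul_sum _ _ _ _).symm
  have emul : ∀ (c : ℝ) (f g : Site d → ℝ), ∑ x ∈ box d (L k), ∑ x' ∈ box d (L k), c * (f x * g x') =
      c * ((∑ x ∈ box d (L k), f x) * (∑ x ∈ box d (L k), g x)) := by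
    intro c f g
    rw [← key, mul_sum]
    exact sum_congr rfl fun x _ => by rw [mul_sum]
  -- summation
  calc |(s k ^ d) ^ 2 * ∑ x ∈ box d (L k), ∑ x' ∈ box d (L k),
          w₁ (s k • siteToE x) * w₂ (s k • siteToE x') * (Φ k x x' - Θ k x x')|
      ≤ (s k ^ d) ^ 2 * ∑ x ∈ box d (L k), ∑ x' ∈ box d (L k),
          |w₁ (s k • siteToE x) * w₂ (s k • siteToE x') * (Φ k x x' - Θ k x x')| := by
        rw [abs_mul, abs_of_pos (by positivity)]
        gcongr
        exact (abs_sum_le_sum_abs _ _).trans (sum_le_sum fun x _ => abs_sum_le_sum_abs _ _)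
    _ ≤ (s k ^ d) ^ 2 * ∑ x ∈ box d (L k), ∑ x' ∈ box d (L k),
          (εn * (|w₁ (s k • siteToE x)| * |w₂ (s k • siteToE x')|) +
          max M 0 * ((if R ≤ ‖s k • siteToE x‖ then |w₁ (s k • siteToE x)| else 0) * |w₂ (s k • siteToE x')|) +
          max M 0 * (|w₁ (s k • siteToE x)| *
            (if R ≤ ‖s k • siteToE x'‖ then |w₂ (s k • siteToE x')| else 0))) := by
        gcongr with x hx x' hx'
        exact hterm x hx x' hx'
    _ = (s k ^ d) ^ 2 * (εn * ((∑ x ∈ box d (L k), |w₁ (s k • siteToE x)|) *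
            (∑ x ∈ box d (L k), |w₂ (s k • siteToE x)|)) +
          max M 0 * ((∑ x ∈ box d (L k), (if R ≤ ‖s k • siteToE x‖ then |w₁ (s k • siteToE x)| else 0)) *
            (∑ x ∈ box d (L k), |w₂ (s k • siteToE x)|)) +
          max M 0 * ((∑ x ∈ box d (L k), |w₁ (s k • siteToE x)|) *
            (∑ x ∈ box d (L k), (if R ≤ ‖s k • siteToE x‖ then |w₂ (s k • siteToE x)| else 0)))) := by
        congr 1
        simp only [sum_add_distrib]
        rw [emul, emul, emul]
    _ = εn * ((s k ^ d * ∑ x ∈ box d (L k), |w₁ (s k • siteToE x)|) *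
            (s k ^ d * ∑ x ∈ box d (L k), |w₂ (s k • siteToE x)|)) +
          max M 0 * ((s k ^ d * ∑ x ∈ box d (L k),
              (if R ≤ ‖s k • siteToE x‖ then |w₁ (s k • siteToE x)| else 0)) *
            (s k ^ d * ∑ x ∈ box d (L k), |w₂ (s k • siteToE x)|)) +
          max M 0 * ((s k ^ d * ∑ x ∈ box d (L k), |w₁ (s k • siteToE x)|) *
            (s k ^ d * ∑ x ∈ box d (L k),
              (if R ≤ ‖s k • siteToE x‖ then |w₂ (s k • siteToE x)| else 0))) := by ring
    _ ≤ εn * (B₁ * B₂) + max M 0 * (B₁' / (1 + R) * B₂) + max M 0 * (B₁ * (B₂' / (1 + R))) :=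
        add_le_add (add_le_add
          (mul_le_mul_of_nonneg_left (mul_le_mul hS₁ hS₂ hT₂0 hB₁0) hεn0.le)
          (mul_le_mul_of_nonneg_left (mul_le_mul hU₁ hS₂ hT₂0 (by positivity)) hMp0))
          (mul_le_mul_of_nonneg_left (mul_le_mul hS₁ hU₂ hV₂0 hB₁0) hMp0)
    _ = εn * (B₁ * B₂) + max M 0 * (B₁' * B₂ + B₁ * B₂') / (1 + R) := by field_simp; ring
    _ < ε := by linarith

end Summit.QuantumFields.YangMills.Cruxes.UniversalDetectorLimitExtraction
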